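import Summits.AtomisticToContinuum.HydrodynamicLimit.Theorems.JaynesSqueezeLocalGibbsConcentrationDiluteDensityLDA
import Summits.AtomisticToContinuum.HydrodynamicLimit.Theorems.JaynesSqueezeLocalGibbsConcentrationDiluteChernoff
import Summits.AtomisticToContinuum.HydrodynamicLimit.Theorems.JaynesSqueezeLocalGibbsConcentrationDiluteVelocityMoments
import Summits.AtomisticToContinuum.HydrodynamicLimit.Theorems.OneFlightGossipEngineUniformLocalGibbsConcentrationFields

/-!
# `HardSphereLDA → LocalGibbsConcentrationDilute` (route `JaynesSqueeze`)

Item `LocalGibbsConcentrationDilute` (stmt-AtomisticToContinuum-13460), the exponential law of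
large numbers for dilute local Gibbs states of hard spheres, is proved CONDITIONALLY on the
route's static local-density package `HardSphereLDA` (item stmt-AtomisticToContinuum-13459;
only its clause (B) — convergence of the MEAN empirical density under the activity
`ρ e^{g_σ(ρ)}` to `ρ` — is used):
`localGibbsConcentrationDilute_of_hardSphereLDA : HardSphereLDA → LocalGibbsConcentrationDilute`,
factored through `localGibbsConcentrationDilute_of_meanLDA` (the same conclusion from the
mean-density law of large numbers for continuous profiles alone).

Assembly (after `localGibbs_lln_of_densityLLN`): the density field is governed by the position
marginal (`posGibbsMeasure_density_concentration_of_LDA`: tilt bound + tilted mean densities);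
the momentum and energy fields split into a density field with the continuous weights `χ u₁ₗ`,
`χ(|u₁|²/2 + 3θ₁/2)` plus a velocity fluctuation which, conditionally on the positions, is an
average of `N + 1` independent centred Gaussian functionals with uniform exponential moments,
hence exponentially small (`localGibbsMeasure_velFluct_le_exp`, `exists_expMoment_velFluct`).

No definitions (pure-proof file). prover-pitem-stmt-AtomisticToContinuum-13460-0.
-/

noncomputable section

namespace Summit.AtomisticToContinuum.HydrodynamicLimit.Theorems

open MeasureTheory ProbabilityTheory Filter Topology Set
open Literature.Analysis.FluidPDE Literature.MathematicalPhysics.KineticTheory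
open Summit.AtomisticToContinuum.HydrodynamicLimit.Theses.JaynesSqueeze
open scoped ENNReal

namespace LocalGibbsConcentration

section Bounds

/-- Monotonicity of the bound `C e^{-(N+1)/C}` in `C`. [folklore] -/
theorem const_mul_exp_mono {C₁ C₂ : ℝ} (hC₁ : 0 < C₁) (h : C₁ ≤ C₂) (N : ℕ) :
    C₁ * Real.exp (-(C₁⁻¹ * (N + 1))) ≤ C₂ * Real.exp (-(C₂⁻¹ * (N + 1))) := by
  have hC₂ : 0 < C₂ := hC₁.trans_le h
  refine mul_le_mul h (Real.exp_le_exp.2 ?_) (Real.exp_pos _).le hC₂.le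
  have : C₂⁻¹ ≤ C₁⁻¹ := inv_anti₀ hC₁ h
  have hN : (0 : ℝ) ≤ N + 1 := by positivity
  nlinarith

/-- **Sum of two exponential bounds.** [folklore] -/
theorem expBound_add {p q : ℕ → ℝ≥0∞}
    (hp : ∃ C : ℝ, 0 < C ∧ ∀ N : ℕ, p N ≤ ENNReal.ofReal (C * Real.exp (-(C⁻¹ * (N + 1)))))
    (hq : ∃ C : ℝ, 0 < C ∧ ∀ N : ℕ, q N ≤ ENNReal.ofReal (C * Real.exp (-(C⁻¹ * (N + 1))))) :
    ∃ C : ℝ, 0 < C ∧ ∀ N : ℕ, p N + q N ≤ ENNReal.ofReal (C * Real.exp (-(C⁻¹ * (N + 1)))) := by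
  obtain ⟨C₁, hC₁, h₁⟩ := hp
  obtain ⟨C₂, hC₂, h₂⟩ := hq
  refine ⟨C₁ + C₂, by positivity, fun N => ?_⟩
  calc p N + q N ≤ ENNReal.ofReal (C₁ * Real.exp (-(C₁⁻¹ * (N + 1)))) +
        ENNReal.ofReal (C₂ * Real.exp (-(C₂⁻¹ * (N + 1)))) := add_le_add (h₁ N) (h₂ N)
    _ = ENNReal.ofReal (C₁ * Real.exp (-(C₁⁻¹ * (N + 1))) + C₂ * Real.exp (-(C₂⁻¹ * (N + 1)))) :=
        (ENNReal.ofReal_add (by positivity) (by positivity)).symm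
    _ ≤ ENNReal.ofReal ((C₁ + C₂) * Real.exp (-((C₁ + C₂)⁻¹ * (N + 1)))) := by
        refine ENNReal.ofReal_le_ofReal ?_
        have e₁ : Real.exp (-(C₁⁻¹ * (N + 1))) ≤ Real.exp (-((C₁ + C₂)⁻¹ * (N + 1))) := by
          rw [Real.exp_le_exp]
          have : (C₁ + C₂)⁻¹ ≤ C₁⁻¹ := inv_anti₀ hC₁ (by linarith)
          have hN : (0 : ℝ) ≤ N + 1 := by positivity
          nlinarith
        have e₂ : Real.exp (-(C₂⁻¹ * (N + 1))) ≤ Real.exp (-((C₁ + C₂)⁻¹ * (N + 1))) := by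
          rw [Real.exp_le_exp]
          have : (C₁ + C₂)⁻¹ ≤ C₂⁻¹ := inv_anti₀ hC₂ (by linarith)
          have hN : (0 : ℝ) ≤ N + 1 := by positivity
          nlinarith
        rw [add_mul]
        exact add_le_add (mul_le_mul_of_nonneg_left e₁ hC₁.le) (mul_le_mul_of_nonneg_left e₂ hC₂.le)

/-- Transfer of an exponential bound along a pointwise inequality. [folklore] -/
theorem expBound_mono {p q : ℕ → ℝ≥0∞} (hpq : ∀ N, p N ≤ q N)
    (hq : ∃ C : ℝ, 0 < C ∧ ∀ N : ℕ, q N ≤ ENNReal.ofReal (C * Real.exp (-(C⁻¹ * (N + 1))))) :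
    ∃ C : ℝ, 0 < C ∧ ∀ N : ℕ, p N ≤ ENNReal.ofReal (C * Real.exp (-(C⁻¹ * (N + 1)))) := by
  obtain ⟨C, hC, h⟩ := hq
  exact ⟨C, hC, fun N => (hpq N).trans (h N)⟩

end Bounds

section Main

variable {a₁ θ₁ : T3 → ℝ} {u₁ : T3 → V3}

/-- **Velocity fluctuation events have an exponential bound** (uniformly in `N`), for a jointly
measurable family of centred per-particle velocity observables with a uniform exponential
moment (`localGibbsMeasure_velFluct_le_exp` packaged by `exists_const_exp_bound`). [folklore] -/
theorem expBound_velFluct (ha : Continuous a₁) (hθ : Continuous θ₁) (hu : Continuous u₁)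
    (ha0 : ∀ x, 0 < a₁ x) (hθ0 : ∀ x, 0 < θ₁ x) {σ : ℝ} (hσ2 : σ ≤ 1 / 2)
    {Y : T3 → V3 → ℝ} (hYm : Measurable fun p : T3 × V3 => Y p.1 p.2)
    (hY0 : ∀ x, ∫ v, Y x v ∂gaussMeasure (u₁ x) (θ₁ x) = 0)
    {t₀ B : ℝ} (ht₀ : 0 < t₀) (hBpos : 0 < B)
    (hYint : ∀ x, Integrable (fun v => Real.exp (t₀ * |Y x v|)) (gaussMeasure (u₁ x) (θ₁ x)))
    (hYB : ∀ x, ∫ v, Real.exp (t₀ * |Y x v|) ∂gaussMeasure (u₁ x) (θ₁ x) ≤ B)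
    {χ : T3 → ℝ} (hχ : Continuous χ) {δ : ℝ} (hδ : 0 < δ) :
    ∃ C : ℝ, 0 < C ∧ ∀ N : ℕ, localGibbsMeasure σ a₁ u₁ θ₁ N
      {z | δ ≤ |((N + 1 : ℕ) : ℝ)⁻¹ * ∑ i, χ (z i).1 * Y (z i).1 (z i).2|} ≤
        ENNReal.ofReal (C * Real.exp (-(C⁻¹ * (N + 1)))) := by
  obtain ⟨K, -, hK⟩ := exists_forall_abs_le_of_continuous hχ
  haveI := fun N => isProbabilityMeasure_localGibbsMeasure ha hθ hu ha0 hθ0 hσ2 N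
  set κ : ℝ := min (t₀ / max K 1 / 2) (δ * (t₀ / max K 1) ^ 2 / (16 * B)) * δ / 2 with hκ
  have hκpos : 0 < κ := by
    have h1 : 0 < t₀ / max K 1 := div_pos ht₀ (lt_max_of_lt_right one_pos)
    have : 0 < min (t₀ / max K 1 / 2) (δ * (t₀ / max K 1) ^ 2 / (16 * B)) :=
      lt_min (by positivity) (by positivity)
    positivity
  refine exists_const_exp_bound (fun N => prob_le_one) (A := 2) hκpos (N₀ := 0) fun N _ => ?_
  have h := localGibbsMeasure_velFluct_le_exp ha hθ hu (fun x => (ha0 x).le) hθ0 σ N hYm hY0 ht₀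
    hBpos hYint hYB hχ hK hδ
  refine h.trans (le_of_eq ?_)
  congr 2
  rw [hκ]; push_cast; ring

/-- **The exponential local equilibrium law of large numbers from the mean-density LDA.** If,
under `HsEosLowDensity`, the mean empirical density of the configurational canonical hard-sphere
gas with activity `ρ e^{g_σ(ρ)}` tends to `ρ` for continuous normalised profiles `ρ` in a dilute
band (`c ≤ ρ`, `ρσ³ ≤ η₁'`), then `LocalGibbsConcentrationDilute` holds: the empirical density,
momentum and energy fields of the local Gibbs laws with activity `a₁ = ρ₁ e^{g_σ(ρ₁)}`
concentrate exponentially. [folklore] -/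
theorem localGibbsConcentrationDilute_of_meanLDA
    (hM : HsEosLowDensity → ∃ η₁' : ℝ, 0 < η₁' ∧ ∀ σ : ℝ, 0 < σ → ∀ c : ℝ, 0 < c →
      ∀ ρ : T3 → ℝ, Continuous ρ → (∀ x, c ≤ ρ x ∧ ρ x * σ ^ 3 ≤ η₁') → ∫ x, ρ x = 1 →
      ∀ f : T3 → ℝ, Continuous f →
      Tendsto (fun N : ℕ => ((N + 1 : ℕ) : ℝ)⁻¹ * ∫ x, ∑ i, f (x i)
        ∂posGibbsMeasure (fun x => ρ x * Real.exp (hsExcessFreeEnergy (ρ x * σ ^ 3) +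
          ρ x * σ ^ 3 * deriv hsExcessFreeEnergy (ρ x * σ ^ 3))) (hsDiameter σ N) (N + 1))
        atTop (𝓝 (∫ x, f x * ρ x))) :
    LocalGibbsConcentrationDilute := by
  intro hEos
  obtain ⟨η₁', hη₁', hM'⟩ := hM hEos
  obtain ⟨η₁, hη₁, hη₁16, hD⟩ := posGibbsMeasure_density_concentration_of_meanLDA hEos hη₁' hM'
  refine ⟨η₁, hη₁, fun σ hσ => ?_⟩
  intro g c hc ρ₁ hρ₁c hband hnorm u₁ θ₁ hu hθ hθ0 a₁ χ hχ δ hδ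
  obtain ⟨ha₁c', hdens⟩ := hD σ hσ c hc ρ₁ hρ₁c hband hnorm
  have ha₁c : Continuous a₁ := ha₁c'
  have hρ₁pos : ∀ x, 0 < ρ₁ x := fun x => hc.trans_le (hband x).1
  have ha₁pos : ∀ x, 0 < a₁ x := fun x => mul_pos (hρ₁pos x) (Real.exp_pos _)
  have hσ2 : σ ≤ 1 / 2 := (sigma_lt_half hσ hρ₁c hnorm fun x => (hband x).2.trans hη₁16).le
  haveI hprob : ∀ N, IsProbabilityMeasure (localGibbsMeasure σ a₁ u₁ θ₁ N) := fun N =>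
    isProbabilityMeasure_localGibbsMeasure ha₁c hθ hu ha₁pos hθ0 hσ2 N
  -- density-type events under the local Gibbs measure, for a general continuous weight `w`
  have hdensL : ∀ w : T3 → ℝ, Continuous w → ∀ δ' : ℝ, 0 < δ' → ∃ C : ℝ, 0 < C ∧ ∀ N : ℕ,
      localGibbsMeasure σ a₁ u₁ θ₁ N
        {z | δ' < |((N + 1 : ℕ) : ℝ)⁻¹ * ∑ i, w (z i).1 - ∫ y, w y * ρ₁ y|} ≤
        ENNReal.ofReal (C * Real.exp (-(C⁻¹ * (N + 1)))) := by
    intro w hw δ' hδ'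
    obtain ⟨C, hC, h⟩ := hdens w hw δ' hδ'
    refine ⟨C, hC, fun N => le_of_eq_of_le ?_ (h N)⟩
    have hS : MeasurableSet {x : Fin (N + 1) → T3 |
        δ' < |((N + 1 : ℕ) : ℝ)⁻¹ * ∑ i, w (x i) - ∫ y, w y * ρ₁ y|} :=
      measurableSet_lt measurable_const ((measurable_const.mul (Finset.measurable_sum _
        fun i _ => hw.measurable.comp (measurable_pi_apply i))).sub measurable_const).abs
    exact localGibbsMeasure_preimage_pos ha₁c hθ hu (fun x => (ha₁pos x).le) hθ0 σ N hS
  -- uniform exponential moments of the velocity fluctuations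
  obtain ⟨t₀, B, ht₀, hB, hmom, hen⟩ := exists_expMoment_velFluct hθ hu hθ0
  -- (1) density
  have h1 : ∃ C : ℝ, 0 < C ∧ ∀ N : ℕ, localGibbsMeasure σ a₁ u₁ θ₁ N
      {z | δ < |empiricalDensityField z χ - ∫ x, χ x * ρ₁ x|} ≤
      ENNReal.ofReal (C * Real.exp (-(C⁻¹ * (N + 1)))) := by
    obtain ⟨C, hC, h⟩ := hdensL χ hχ δ hδ
    refine ⟨C, hC, fun N => le_of_eq_of_le ?_ (h N)⟩
    simp only [empiricalDensityField_eq_sum]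
  -- (2) momentum, coordinatewise
  set I : V3 := ∫ x, (χ x * ρ₁ x) • u₁ x with hI
  have hIl : ∀ l : Fin 3, I l = ∫ x, χ x * u₁ x l * ρ₁ x := by
    intro l
    have hint : Integrable (fun x => (χ x * ρ₁ x) • u₁ x) :=
      integrable_of_continuous_T3 ((hχ.mul hρ₁c).smul hu)
    rw [hI, show (∫ x, (χ x * ρ₁ x) • u₁ x) l =
        (EuclideanSpace.proj l : V3 →L[ℝ] ℝ) (∫ x, (χ x * ρ₁ x) • u₁ x) from rfl,
      ← ContinuousLinearMap.integral_comp_comm _ hint]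
    refine integral_congr_ae (Eventually.of_forall fun x => ?_)
    simp only [EuclideanSpace.coe_proj, PiLp.smul_apply, smul_eq_mul]
    ring
  have hcoord : ∀ l : Fin 3, ∃ C : ℝ, 0 < C ∧ ∀ N : ℕ, localGibbsMeasure σ a₁ u₁ θ₁ N
      {w | δ / 3 < |(empiricalMomentumField w χ - I) l|} ≤
      ENNReal.ofReal (C * Real.exp (-(C⁻¹ * (N + 1)))) := by
    intro l
    have hA := expBound_velFluct ha₁c hθ hu ha₁pos hθ0 hσ2 (Y := fun x v => v l - u₁ x l)
      (by fun_prop)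
      (fun x => by
        rw [integral_sub ((memLp_coord_gaussMeasure (u₁ x) (θ₁ x) l 2 (by simp)).integrable
          one_le_two) (integrable_const _), integral_coord_gaussMeasure _ (hθ0 x), integral_const]
        simp)
      ht₀ hB (fun x => (hmom x l).1) (fun x => (hmom x l).2) hχ (δ := δ / 6) (by positivity)
    have hB' := hdensL (fun y => χ y * u₁ y l) (hχ.mul (by fun_prop)) (δ / 6) (by positivity)
    refine expBound_mono (fun N => ?_) (expBound_add hA hB')
    have hset : {w : Config (N + 1) (Fin 3) T3 | δ / 3 < |(empiricalMomentumField w χ - I) l|} =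
        {w | 2 * (δ / 6) < |((N + 1 : ℕ) : ℝ)⁻¹ * ∑ i, χ (w i).1 * ((w i).2 l - u₁ (w i).1 l) +
          (((N + 1 : ℕ) : ℝ)⁻¹ * ∑ i, χ (w i).1 * u₁ (w i).1 l - ∫ y, χ y * u₁ y l * ρ₁ y)|} := by
      ext w
      simp only [Set.mem_setOf_eq]
      rw [PiLp.sub_apply, empiricalMomentumField_apply_sub w χ u₁ l (I l), hIl,
        show (2 : ℝ) * (δ / 6) = δ / 3 by ring]
    rw [hset]
    exact UniformLGC.measure_lt_abs_add_le _ _ _ _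
  have h2 : ∃ C : ℝ, 0 < C ∧ ∀ N : ℕ, localGibbsMeasure σ a₁ u₁ θ₁ N
      {z | δ < ‖empiricalMomentumField z χ - I‖} ≤
      ENNReal.ofReal (C * Real.exp (-(C⁻¹ * (N + 1)))) := by
    obtain ⟨C0, hC0, h0⟩ := hcoord 0
    obtain ⟨C1, hC1, h1'⟩ := hcoord 1
    obtain ⟨C2, hC2, h2'⟩ := hcoord 2
    refine expBound_mono (fun N => ?_) (expBound_add (expBound_add ⟨C0, hC0, h0⟩ ⟨C1, hC1, h1'⟩)
      ⟨C2, hC2, h2'⟩)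
    refine (measure_setOf_lt_norm_le _ (fun w => empiricalMomentumField w χ - I) hδ.le).trans ?_
    rw [Fin.sum_univ_three]
  -- (3) energy
  have hIe : ∫ x, χ x * totalEnergyDensity (ρ₁ x) (u₁ x) (θ₁ x) =
      ∫ x, χ x * (‖u₁ x‖ ^ 2 / 2 + Fintype.card (Fin 3) * θ₁ x / 2) * ρ₁ x := by
    refine integral_congr_ae (Eventually.of_forall fun x => ?_)
    simp only [totalEnergyDensity, Fintype.card_fin, Nat.cast_ofNat]
    ring
  have h3 : ∃ C : ℝ, 0 < C ∧ ∀ N : ℕ, localGibbsMeasure σ a₁ u₁ θ₁ N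
      {z | δ < |empiricalEnergyField z χ -
        ∫ x, χ x * totalEnergyDensity (ρ₁ x) (u₁ x) (θ₁ x)|} ≤
      ENNReal.ofReal (C * Real.exp (-(C⁻¹ * (N + 1)))) := by
    have hA := expBound_velFluct ha₁c hθ hu ha₁pos hθ0 hσ2
      (Y := fun x v => ‖v‖ ^ 2 / 2 - ‖u₁ x‖ ^ 2 / 2 - Fintype.card (Fin 3) * θ₁ x / 2)
      (by fun_prop) (fun x => integral_energy_gaussMeasure (u₁ x) (hθ0 x))
      ht₀ hB (fun x => (hen x).1) (fun x => (hen x).2) hχ (δ := δ / 2) (by positivity)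
    have hB' := hdensL (fun y => χ y * (‖u₁ y‖ ^ 2 / 2 + Fintype.card (Fin 3) * θ₁ y / 2))
      (by fun_prop) (δ / 2) (by positivity)
    refine expBound_mono (fun N => ?_) (expBound_add hA hB')
    have hset : {z : Config (N + 1) (Fin 3) T3 | δ < |empiricalEnergyField z χ -
        ∫ x, χ x * totalEnergyDensity (ρ₁ x) (u₁ x) (θ₁ x)|} =
        {z | 2 * (δ / 2) < |((N + 1 : ℕ) : ℝ)⁻¹ * ∑ i, χ (z i).1 * (‖(z i).2‖ ^ 2 / 2 -
          ‖u₁ (z i).1‖ ^ 2 / 2 - Fintype.card (Fin 3) * θ₁ (z i).1 / 2) +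
          (((N + 1 : ℕ) : ℝ)⁻¹ * ∑ i, χ (z i).1 * (‖u₁ (z i).1‖ ^ 2 / 2 +
            Fintype.card (Fin 3) * θ₁ (z i).1 / 2) -
            ∫ y, χ y * (‖u₁ y‖ ^ 2 / 2 + Fintype.card (Fin 3) * θ₁ y / 2) * ρ₁ y)|} := by
      ext z
      simp only [Set.mem_setOf_eq]
      rw [empiricalEnergyField_sub z χ u₁ θ₁ _, hIe, show (2 : ℝ) * (δ / 2) = δ by ring]
    rw [hset]
    exact UniformLGC.measure_lt_abs_add_le _ _ _ _
  -- assembly of the three clauses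
  obtain ⟨C₁, hC₁, H₁⟩ := h1
  obtain ⟨C₂, hC₂, H₂⟩ := h2
  obtain ⟨C₃, hC₃, H₃⟩ := h3
  refine ⟨C₁ + C₂ + C₃, by positivity, fun N Φ => ⟨?_, ?_, ?_⟩⟩
  · rw [localGibbsLaw_eq]
    exact (H₁ N).trans (ENNReal.ofReal_le_ofReal (const_mul_exp_mono hC₁ (by linarith) N))
  · rw [localGibbsLaw_eq]
    exact (H₂ N).trans (ENNReal.ofReal_le_ofReal (const_mul_exp_mono hC₂ (by linarith) N))
  · rw [localGibbsLaw_eq]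
    exact (H₃ N).trans (ENNReal.ofReal_le_ofReal (const_mul_exp_mono hC₃ (by linarith) N))

/-- **`HardSphereLDA → LocalGibbsConcentrationDilute`.** The exponential law of large numbers for
the empirical density, momentum and energy fields of dilute local Gibbs states with activity
`a₁ = ρ₁ e^{g_σ(ρ₁)}` (packing-only smallness `ρ₁ σ³ ≤ η₁`), conditionally on the static LDA
package `HardSphereLDA` of the route (item stmt-AtomisticToContinuum-13459; only clause (B) is
used, through `meanLDA_of_hardSphereLDA`). [folklore] -/
theorem localGibbsConcentrationDilute_of_hardSphereLDA (hLDA : HardSphereLDA) :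
    LocalGibbsConcentrationDilute :=
  localGibbsConcentrationDilute_of_meanLDA fun hEos => meanLDA_of_hardSphereLDA hEos hLDA

end Main

end LocalGibbsConcentration

end Summit.AtomisticToContinuum.HydrodynamicLimit.Theorems
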